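import Literature.MathematicalPhysics.QuantumFieldTheory.Balaban1983to89.B10Eq18SigmaSU2Haar
import Literature.MathematicalPhysics.QuantumFieldTheory.Balaban1983to89.T4HaarSU2Translate

/-!
# NODE O port PT-A — socket (o2) = brick (h2): THE RECORD's HAAR EXP-CHART JACOBIAN — print's «dV ↦ dB′σ(B′)» of [I] (2.10) p.267 («where the factors σ₀ are included into the
# normalization factor 𝐍*_k»): the product Haar measure of the level-`k` bond variables on a window `{V : V(b) = exp(iB′(b))·V^{(k)}(b), |B′(b)| < s}` around ANY centre `V^{(k)}`,
# `s ≤ π`, IS `σ₀^{#bonds} · (Π_b (σ∕σ₀)(|B′(b)|)) · d B′` pushed forward by the chart `B′ ↦ exp(iB′)·V^{(k)}` ([I] (2.4) `V = V′V^{(k)}`, `V′ = exp(iB′)`), with `σ∕σ₀ = (sin|A|∕|A|)²` the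
# normalised Haar density of `SU(2)` in the Pauli chart ([16] (18) p.260 «dU′ = σ(A′)dA′») — THIS FILE: ONE BOND (+ the folklore product-measure lemmas the sequels use); MANY BONDS (any finite bond set, any centre) = sequel
# `…PortS1ChartJacobianPi.lean`; the reading at the RECORD's flat coordinates `x : FluctIdx F k K → ℝ` of ★★ DEF-1's `…K0RecordFormatNamesFluct` (`fluctMat`, `pert`,
# `fieldMeasure`) = sequel `…PortS1ChartJacobianRecord.lean`

Cell `ym-nodeO-ideate`, porter seat `ymgap-nodeO-port-PTA-1` (gen 9, lead of the line `pta-residueW` of ⟨stmt-QuantumFields-27930⟩ `PortRecordRepresentationS1`); `--kind definition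
--supports stmt-QuantumFields-27930 --as helper` (★★★ director-ym №576 DISPATCH «(o2) = (h2) record Haar exp-chart Jacobian socket — ONE defs leaf»; ★★ DEF-1 g39 DESIGN WORD (D5): «the record
instance of ✓`HaarExpChartChangeOfVariables` at a non-central bond ⇒ a def of the chart Jacobian density on `fluctG = ℝ³` per bond + its change-of-variables face; P0-free, S»).  It is ONE of the
four stage-2 sockets (o1)–(o4) of DEF-1's closed `recordFluctInt` (FE-SPLIT-PROPOSAL-v2 §2); the FE half `stub_FE` stays XXL ∕ blocked-unbuilt.
[I] = [Balaban1987RG1] (2.4) p.266, (2.10) p.267; [16] = [Balaban1985UV3] (18) p.260; [Hel] = [Helgason2000] Ch. I §1 Thm. 1.14.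

WHY NOT JUST dag-n09-w4's ✓`FieldMeasureExpChartChangeOfVariables` (p28's abstract chart on the matrix Lie algebra `(specialUnitaryLogChart (Fin N)).lie`, radius `s ≤ s_C = log(4∕3)` for
`N = 2`, density `jacDensity`, window constant a ratio): the record's fluctuation variable lives on `fluctG3 = EuclideanSpace ℝ (Fin 3)` (DEF-1 ✓`…FluctRatioC` :209) ∕ the flat
`FluctIdx F k K → ℝ` (DEF-1 ✓`…Fluct` :66), the chart is print's Pauli chart `A ↦ exp(iΣA^aσ_a)` (= `B10Eq18SigmaSU2Haar.expPauli`, injective on `|A| < π`), the density is the EXPLICIT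
`(sin|A|∕|A|)²` and the constant the EXPLICIT `σ₀ = 1∕2π²` (`B10Eq22Rescaling.sigmaSU2 0`) — all four already certified one bond at a time by r07∕r10∕pub-balaban (`B10Eq18SigmaSU2Haar`, `T4HaarSU2ExpChart`);
this file tensors them over the bonds, translates the window to an arbitrary centre by right-invariance, and reads the result at DEF-1's names.  Regime displayed: `s ≤ π` (no `0 < s` needed).

CONTENT (sorry-free; Mathlib + BUILT tree only):
* §0 (folklore measure theory, self-contained): `lintegral_prod_pi` (Tonelli for `Π_b f_b(x_b)` on a finite product), `pi_withDensity` (`⊗_b (f_b·κ_b) = (Π_b f_b)·⊗_b κ_b`),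
  `measurePreserving_uncurry` (uncurrying `(ι → κ → ℝ) ≃ (ι × κ → ℝ)` preserves Lebesgue measure; the curried direction is its `.symm`, cf. the tree's
  `AllWindowsColdBoxBoxHighLine.PauliChartFlattening.measurePreserving_curry`, not imported to keep this leaf's closure inside the Bałaban files).
* §1 ONE BOND: ★ def `chartJac A := σ_{SU(2)}(|A|)∕σ₀` (`= (sin|A|∕|A|)² = det jac(iA)`; `chartJac_eq_sinc_sq`, `_nonneg`, `_le_one`, `_zero`, `continuous_`, `measurable_`,
  `ofReal_sigmaSU2_eq`), def `chartAt u A := expPauli A · u` (print's `V′V^{(k)}` on one bond), ★★ `haar_restrict_chartAt_image` (MEASURE FORM: `dU|_{exp(iB_s)·u} = (A ↦ exp(iA)·u)_*(σ dA|_{B_s})`),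
  ★★ `setLIntegral_haar_chartAt_image` (`∫_{exp(iB_s)·u} G dU = σ₀ ∫_{B_s} G(exp(iA)·u)·chartJac(A) d³A`).
* MANY BONDS (`chartPi`, `fluctSigma` = print's `σ(B′)`, the product-window identities) and AT THE RECORD (DEF-1's `fluctMat` ∕ `pert` ∕ `fieldMeasure`): the two sequels (same seat).

HONEST FRAMING.  Measure-theoretic bookkeeping over certified one-bond facts (r07∕r10∕pub-balaban) — the Jacobian of a chart; NOTHING of Bałaban's renormalization-group estimates is asserted,
ported or discharged; the linearisation `B′ ↦ B₁ = B′ − hD̃(B′)` of (2.10)–(2.11) ((o1) `D̃`), `Tr log` of its Jacobian ((o3)) and `E_k` in the chart ((o4)) are NOT here; `stub_P0C` ∕ `stub_FE`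
OPEN (registry 1∕3 via `stub_G3C` by name); ⟨27930⟩ ⁸-Ax-LR4 OPEN · no claim; NODE O 0∕1; COUNT 8∕28 · K 1∕4 UNMOVED; finite `𝕋⁴_{L^K}` at fixed ε — NOT continuum ∕ OS ∕ Clay; **the
Yang–Mills mass gap is NOT proved by any of this.**  No `sorry`, no `instance`, no `notation`; standard axioms.
-/

noncomputable section

open MeasureTheory MeasureTheory.Measure Set Metric
open scoped ENNReal BigOperators

namespace Summit.QuantumFields.YangMills.Theorems.BalabanUVNodesPortS1

open Literature.MathematicalPhysics.QuantumFieldTheory (haarProbability)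
open Literature.MathematicalPhysics.QuantumFieldTheory.Balaban1983to89
open Literature.MathematicalPhysics.QuantumFieldTheory.Balaban1983to89.B10Eq22Rescaling (sigmaSU2 sigmaSU2_zero)
open Literature.MathematicalPhysics.QuantumFieldTheory.Balaban1983to89.B10Eq18SigmaSU2Haar
open Literature.MathematicalPhysics.QuantumFieldTheory.Balaban1983to89.T4HaarSU2ExpChart (expWeight)

/-! ## §0  Folklore measure theory on finite products (self-contained; Mathlib only) -/

section Folklore

variable {ι : Type*} [Fintype ι] {E : Type*} [MeasurableSpace E]

omit [Fintype ι] in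
/-- `∫ c·Π_{i∈s} f_i(x_i)` marginalised over `s` is `c·Π_{i∈s} ∫ f_i dκ_i`. [folklore] -/
theorem lmarginal_const_mul_prod (κ : ι → Measure E) [∀ i, SigmaFinite (κ i)] {f : ι → E → ℝ≥0∞} (hf : ∀ i, Measurable (f i))
    [DecidableEq ι] (s : Finset ι) :
    ∀ (c : ℝ≥0∞) (x : ι → E), (∫⋯∫⁻_s, (fun y => c * ∏ i ∈ s, f i (y i)) ∂κ) x = c * ∏ i ∈ s, ∫⁻ y, f i y ∂(κ i) := by
  induction s using Finset.induction_on with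
  | empty =>
    intro c x
    simp only [lmarginal_empty, Finset.prod_empty, mul_one]
  | @insert i s hi ih =>
    intro c x
    have hmeas : Measurable fun y : ι → E => c * ∏ j ∈ insert i s, f j (y j) :=
      measurable_const.mul (Finset.measurable_prod _ fun j _ => (hf j).comp (measurable_pi_apply j))
    rw [lmarginal_insert' _ hmeas hi]
    have hfun : (fun y : ι → E => ∫⁻ t, (fun z : ι → E => c * ∏ j ∈ insert i s, f j (z j)) (Function.update y i t) ∂κ i)
        = fun y => (c * ∫⁻ t, f i t ∂κ i) * ∏ j ∈ s, f j (y j) := by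
      funext y
      have hpt : ∀ t, c * ∏ j ∈ insert i s, f j (Function.update y i t j) = (c * ∏ j ∈ s, f j (y j)) * f i t := by
        intro t
        rw [Finset.prod_insert hi, Function.update_self,
          Finset.prod_congr rfl (fun j hj => by rw [Function.update_of_ne (ne_of_mem_of_not_mem hj hi)])]
        ring
      simp only [hpt]
      rw [lintegral_const_mul _ (hf i)]
      ring
    rw [hfun, ih, Finset.prod_insert hi]
    ring

/-- **TONELLI ON A FINITE PRODUCT**: `∫ Π_i f_i(x_i) d(⊗_i κ_i) = Π_i ∫ f_i dκ_i`. [folklore] -/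
theorem lintegral_prod_pi (κ : ι → Measure E) [∀ i, SigmaFinite (κ i)] {f : ι → E → ℝ≥0∞} (hf : ∀ i, Measurable (f i)) (x₀ : ι → E) :
    ∫⁻ x, ∏ i, f i (x i) ∂(Measure.pi κ) = ∏ i, ∫⁻ y, f i y ∂(κ i) := by
  classical
  rw [lintegral_eq_lmarginal_univ x₀]
  have h := lmarginal_const_mul_prod κ hf Finset.univ 1 x₀
  simp only [one_mul] at h
  exact h

/-- **`⊗_i (f_i · κ_i) = (Π_i f_i(x_i)) · ⊗_i κ_i`**: a finite product of measures with densities is the product measure with the product density. [folklore] -/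
theorem pi_withDensity (κ : ι → Measure E) [∀ i, SigmaFinite (κ i)] {f : ι → E → ℝ≥0∞} (hf : ∀ i, Measurable (f i))
    [∀ i, SigmaFinite ((κ i).withDensity (f i))] (x₀ : ι → E) :
    Measure.pi (fun i => (κ i).withDensity (f i)) = (Measure.pi κ).withDensity (fun x => ∏ i, f i (x i)) := by
  refine Measure.pi_eq (μ := fun i => (κ i).withDensity (f i)) fun s hs => ?_
  rw [withDensity_apply _ (MeasurableSet.univ_pi hs), Measure.restrict_pi_pi,
    lintegral_prod_pi (fun i => (κ i).restrict (s i)) hf x₀]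
  exact Finset.prod_congr rfl fun i _ => by rw [withDensity_apply _ (hs i)]

/-- **UNCURRYING PRESERVES LEBESGUE MEASURE**: `(ι → κ → ℝ) → (ι × κ → ℝ)`, `f ↦ ((i,j) ↦ f i j)` maps `volume` to `volume` (finite `ι`, `κ`). [folklore] -/
theorem measurePreserving_uncurry (ι κ : Type*) [Fintype ι] [Fintype κ] :
    MeasurePreserving (MeasurableEquiv.curry ι κ ℝ).symm (volume : Measure (ι → κ → ℝ)) (volume : Measure (ι × κ → ℝ)) where
  measurable := (MeasurableEquiv.curry ι κ ℝ).symm.measurable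
  map_eq := by
    rw [volume_pi]
    refine (Measure.pi_eq fun s hs => ?_).symm
    rw [MeasurableEquiv.map_apply, MeasurableEquiv.coe_curry_symm]
    have hpre : Function.uncurry ⁻¹' Set.univ.pi s = Set.univ.pi fun i : ι => Set.univ.pi fun j : κ => s (i, j) := by
      ext f
      simp only [Set.mem_preimage, Set.mem_univ_pi, Function.uncurry_apply_pair, Prod.forall]
    rw [hpre, Measure.pi_pi]
    simp_rw [volume_pi_pi]
    rw [← Finset.univ_product_univ, Finset.prod_product]

end Folklore

/-! ## §1  ONE BOND: the normalised chart Jacobian `σ∕σ₀ = (sin|A|∕|A|)²` and Haar measure on a translated chart window -/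

section OneBond

/-- ★ **THE NORMALISED HAAR DENSITY OF `SU(2)` IN THE PAULI CHART** `A ↦ exp(iΣ_aA^aσ_a)`: `chartJac A := σ_{SU(2)}(|A|)∕σ₀ = (sin|A|∕|A|)² = det jac(iA)` — the Jacobian of print's
change of variables `dV ↦ dB′σ(B′)` per bond, the constant `σ₀ = 1∕2π²` being «included into the normalization factor» ([I] p.267). [cite: Balaban1987RG1, (2.10) p.267]
[cite: Balaban1985UV3, (18) p.260] [cite: Helgason2000, Ch. I §1 Thm. 1.14 (13) p. 96] -/
def chartJac (A : EuclideanSpace ℝ (Fin 3)) : ℝ := sigmaSU2 ‖A‖ / sigmaSU2 0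

/-- `chartJac A = sinc²|A| = (sin|A|∕|A|)²` (`= 1` at `A = 0`). [cite: Balaban1985UV3, (18) p.260] -/
theorem chartJac_eq_sinc_sq (A : EuclideanSpace ℝ (Fin 3)) : chartJac A = Real.sinc ‖A‖ ^ 2 := by
  rw [chartJac, sigmaSU2_norm_eq_expWeight, sigmaSU2_zero, expWeight]
  have h : (2 * Real.pi ^ 2 : ℝ) ≠ 0 := by positivity
  field_simp

/-- `0 ≤ chartJac A`. [cite: Balaban1985UV3, (18) p.260] -/
theorem chartJac_nonneg (A : EuclideanSpace ℝ (Fin 3)) : 0 ≤ chartJac A := by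
  rw [chartJac_eq_sinc_sq]
  positivity

/-- `chartJac A ≤ 1` (`|sinc| ≤ 1`). [cite: Balaban1985UV3, (18) p.260] -/
theorem chartJac_le_one (A : EuclideanSpace ℝ (Fin 3)) : chartJac A ≤ 1 := by
  rw [chartJac_eq_sinc_sq, sq_le_one_iff_abs_le_one]
  exact Real.abs_sinc_le_one ‖A‖

/-- `chartJac 0 = 1` (the chart is normalised at the centre). [cite: Balaban1985UV3, (18) p.260] -/
theorem chartJac_zero : chartJac 0 = 1 := by
  rw [chartJac, norm_zero]
  exact div_self (by rw [sigmaSU2_zero]; positivity)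

/-- `chartJac` is continuous (`sinc²` of the norm). [folklore] -/
theorem continuous_chartJac : Continuous chartJac := by
  have h : chartJac = fun A : EuclideanSpace ℝ (Fin 3) => Real.sinc ‖A‖ ^ 2 := funext chartJac_eq_sinc_sq
  rw [h]
  exact (Real.continuous_sinc.comp continuous_norm).pow 2

/-- `chartJac` is measurable. [folklore] -/
theorem measurable_chartJac : Measurable chartJac := continuous_chartJac.measurable

/-- `A ↦ ofReal (chartJac A)` is measurable. [folklore] -/
theorem measurable_ofReal_chartJac : Measurable fun A : EuclideanSpace ℝ (Fin 3) => ENNReal.ofReal (chartJac A) :=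
  measurable_chartJac.ennreal_ofReal

/-- **`σ(|A|) = σ₀ · chartJac A`** in `ℝ≥0∞`: the un-normalised Haar density of [16] (18) is `σ₀` times the Jacobian. [cite: Balaban1985UV3, (18) p.260] -/
theorem ofReal_sigmaSU2_eq (A : EuclideanSpace ℝ (Fin 3)) :
    ENNReal.ofReal (sigmaSU2 ‖A‖) = ENNReal.ofReal (sigmaSU2 0) * ENNReal.ofReal (chartJac A) := by
  have h0 : 0 < sigmaSU2 0 := by rw [sigmaSU2_zero]; positivity
  rw [← ENNReal.ofReal_mul h0.le, chartJac, mul_div_cancel₀ _ h0.ne']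

/-- print's `V = V′·V^{(k)}`, `V′ = exp(iB′)` ON ONE BOND: the Pauli chart centred (by right translation) at `u ∈ SU(2)`. [cite: Balaban1987RG1, (2.4) p.266] -/
def chartAt (u : Matrix.specialUnitaryGroup (Fin 2) ℂ) (A : EuclideanSpace ℝ (Fin 3)) : Matrix.specialUnitaryGroup (Fin 2) ℂ := expPauli A * u

/-- Unfolding. [cite: Balaban1987RG1, (2.4) p.266] -/
theorem chartAt_apply (u : Matrix.specialUnitaryGroup (Fin 2) ℂ) (A : EuclideanSpace ℝ (Fin 3)) : chartAt u A = expPauli A * u := rfl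

/-- At `A = 0` the chart sits at its centre: `chartAt u 0 = u`. [cite: Balaban1987RG1, (2.4) p.266] -/
theorem chartAt_zero (u : Matrix.specialUnitaryGroup (Fin 2) ℂ) : chartAt u 0 = u := by rw [chartAt, expPauli_zero, one_mul]

/-- `chartAt u` is continuous. [folklore] -/
theorem continuous_chartAt (u : Matrix.specialUnitaryGroup (Fin 2) ℂ) : Continuous (chartAt u) := continuous_expPauli.mul continuous_const

/-- `chartAt u` is measurable. [folklore] -/
theorem measurable_chartAt (u : Matrix.specialUnitaryGroup (Fin 2) ℂ) : Measurable (chartAt u) := (continuous_chartAt u).measurable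

/-- `chartAt u = (· * u) ∘ expPauli`. [folklore] -/
theorem chartAt_eq_comp (u : Matrix.specialUnitaryGroup (Fin 2) ℂ) : chartAt u = (fun g => g * u) ∘ expPauli := rfl

/-- The translated window is the right translate of the centred one: `chartAt u '' W = (· * u) '' (expPauli '' W)`. [folklore] -/
theorem image_chartAt (u : Matrix.specialUnitaryGroup (Fin 2) ℂ) (W : Set (EuclideanSpace ℝ (Fin 3))) :
    chartAt u '' W = (fun g => g * u) '' (expPauli '' W) := by rw [chartAt_eq_comp, image_comp]

/-- `chartAt u` is injective on the injectivity ball `|A| < π` of the Pauli chart. [cite: Balaban1985UV3, p.260] -/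
theorem injOn_chartAt (u : Matrix.specialUnitaryGroup (Fin 2) ℂ) : InjOn (chartAt u) (ball (0 : EuclideanSpace ℝ (Fin 3)) Real.pi) := by
  intro A hA B hB h
  exact injOn_expPauli hA hB (mul_right_cancel h)

/-- The translated chart window is Borel (for a Borel `W ⊆ {|A| < π}`). [folklore] -/
theorem measurableSet_image_chartAt (u : Matrix.specialUnitaryGroup (Fin 2) ℂ) {W : Set (EuclideanSpace ℝ (Fin 3))} (hW : MeasurableSet W)
    (hWπ : W ⊆ ball (0 : EuclideanSpace ℝ (Fin 3)) Real.pi) : MeasurableSet (chartAt u '' W) :=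
  hW.image_of_continuousOn_injOn (continuous_chartAt u).continuousOn ((injOn_chartAt u).mono hWπ)

/-- print's `σ(A′)dA′` restricted to the window `|A′| < s ≤ π` is Lebesgue measure on the ball with density `σ_{SU(2)}(|A|)`. [cite: Balaban1985UV3, (18) p.260] -/
theorem sigmaMeasure_restrict_ball {s : ℝ} (hs : s ≤ Real.pi) :
    sigmaMeasure.restrict (ball (0 : EuclideanSpace ℝ (Fin 3)) s) =
      (volume.restrict (ball (0 : EuclideanSpace ℝ (Fin 3)) s)).withDensity fun A => ENNReal.ofReal (sigmaSU2 ‖A‖) := by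
  rw [sigmaMeasure, restrict_withDensity measurableSet_ball, Measure.restrict_restrict measurableSet_ball, inter_eq_left.2 (ball_subset_ball hs)]

/-- The same with the normalised density: `σ dA|_{B_s} = σ₀ • (chartJac · dA|_{B_s})`. [cite: Balaban1985UV3, (18) p.260] [cite: Balaban1987RG1, (2.10) p.267] -/
theorem sigmaMeasure_restrict_ball_eq_smul {s : ℝ} (hs : s ≤ Real.pi) :
    sigmaMeasure.restrict (ball (0 : EuclideanSpace ℝ (Fin 3)) s) =
      ENNReal.ofReal (sigmaSU2 0) • (volume.restrict (ball (0 : EuclideanSpace ℝ (Fin 3)) s)).withDensity fun A => ENNReal.ofReal (chartJac A) := by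
  rw [sigmaMeasure_restrict_ball hs]
  have h : (fun A : EuclideanSpace ℝ (Fin 3) => ENNReal.ofReal (sigmaSU2 ‖A‖)) =
      ENNReal.ofReal (sigmaSU2 0) • fun A => ENNReal.ofReal (chartJac A) := by
    funext A
    rw [Pi.smul_apply, smul_eq_mul, ofReal_sigmaSU2_eq]
  rw [h, withDensity_smul _ measurable_ofReal_chartJac]

/-- Right translations preserve normalised Haar measure on `SU(2)` (the cell's `HaarData.map_mul_right`, `HaarData.haar = haarProbability` by `rfl`). [folklore] -/
theorem haar_map_mul_right (u : Matrix.specialUnitaryGroup (Fin 2) ℂ) :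
    (haarProbability (Matrix.specialUnitaryGroup (Fin 2) ℂ)).map (fun g => g * u) = haarProbability (Matrix.specialUnitaryGroup (Fin 2) ℂ) := by
  have h := T4HaarSU2Translate.haar_map_mul_mul 1 u
  simp only [one_mul] at h
  exact h

/-- ★★ **HAAR MEASURE ON A TRANSLATED CHART WINDOW (measure form, one bond)**: for every centre `u ∈ SU(2)` and radius `s ≤ π`,
`dU|_{{exp(iA)·u : |A| < s}} = (A ↦ exp(iA)·u)_*(σ_{SU(2)}(|A|) d³A|_{|A|<s})` — [16] (18) «dU′ = σ(A′)dA′» centred at `u` by right-invariance of Haar measure.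
[cite: Balaban1985UV3, (18) p.260] [cite: Balaban1987RG1, (2.4) p.266, (2.10) p.267] -/
theorem haar_restrict_chartAt_image (u : Matrix.specialUnitaryGroup (Fin 2) ℂ) {s : ℝ} (hs : s ≤ Real.pi) :
    (haarProbability (Matrix.specialUnitaryGroup (Fin 2) ℂ)).restrict (chartAt u '' ball (0 : EuclideanSpace ℝ (Fin 3)) s) =
      (sigmaMeasure.restrict (ball (0 : EuclideanSpace ℝ (Fin 3)) s)).map (chartAt u) := by
  have h0 := haarProbability_restrict_image_expPauli (W := ball (0 : EuclideanSpace ℝ (Fin 3)) s) measurableSet_ball (ball_subset_ball hs)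
  set e : Matrix.specialUnitaryGroup (Fin 2) ℂ ≃ᵐ Matrix.specialUnitaryGroup (Fin 2) ℂ := MeasurableEquiv.mulRight u with he
  have hecoe : (e : Matrix.specialUnitaryGroup (Fin 2) ℂ → Matrix.specialUnitaryGroup (Fin 2) ℂ) = fun g => g * u := MeasurableEquiv.coe_mulRight u
  calc (haarProbability (Matrix.specialUnitaryGroup (Fin 2) ℂ)).restrict (chartAt u '' ball (0 : EuclideanSpace ℝ (Fin 3)) s)
      = ((haarProbability (Matrix.specialUnitaryGroup (Fin 2) ℂ)).map e).restrict (e '' (expPauli '' ball (0 : EuclideanSpace ℝ (Fin 3)) s)) := by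
        rw [hecoe, haar_map_mul_right, image_chartAt]
    _ = ((haarProbability (Matrix.specialUnitaryGroup (Fin 2) ℂ)).restrict (e ⁻¹' (e '' (expPauli '' ball (0 : EuclideanSpace ℝ (Fin 3)) s)))).map e :=
        e.measurableEmbedding.restrict_map _ _
    _ = ((haarProbability (Matrix.specialUnitaryGroup (Fin 2) ℂ)).restrict (expPauli '' ball (0 : EuclideanSpace ℝ (Fin 3)) s)).map e := by
        rw [e.injective.preimage_image]
    _ = ((sigmaMeasure.restrict (ball (0 : EuclideanSpace ℝ (Fin 3)) s)).map expPauli).map e := by rw [h0]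
    _ = (sigmaMeasure.restrict (ball (0 : EuclideanSpace ℝ (Fin 3)) s)).map (chartAt u) := by
        rw [Measure.map_map e.measurable measurable_expPauli, hecoe, ← chartAt_eq_comp]

/-- ★★ The same against Lebesgue measure with the normalised Jacobian: `dU|_{{exp(iA)·u : |A| < s}} = σ₀ • (A ↦ exp(iA)·u)_*(chartJac(A) d³A|_{|A|<s})`.
[cite: Balaban1985UV3, (18) p.260] [cite: Balaban1987RG1, (2.10) p.267] -/
theorem haar_restrict_chartAt_image_eq_smul (u : Matrix.specialUnitaryGroup (Fin 2) ℂ) {s : ℝ} (hs : s ≤ Real.pi) :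
    (haarProbability (Matrix.specialUnitaryGroup (Fin 2) ℂ)).restrict (chartAt u '' ball (0 : EuclideanSpace ℝ (Fin 3)) s) =
      ENNReal.ofReal (sigmaSU2 0) •
        ((volume.restrict (ball (0 : EuclideanSpace ℝ (Fin 3)) s)).withDensity fun A => ENNReal.ofReal (chartJac A)).map (chartAt u) := by
  rw [haar_restrict_chartAt_image u hs, sigmaMeasure_restrict_ball_eq_smul hs, Measure.map_smul]

/-- ★★ **«dU′ = σ(A′)dA′» ON A TRANSLATED WINDOW, EVERY MEASURABLE INTEGRAND (one bond)**: for `u ∈ SU(2)`, `s ≤ π`, measurable `G ≥ 0`,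
`∫_{{exp(iA)·u : |A|<s}} G dU = σ₀ · ∫_{|A|<s} G(exp(iA)·u) · chartJac(A) d³A`. [cite: Balaban1985UV3, (18) p.260] [cite: Balaban1987RG1, (2.4) p.266, (2.10) p.267] -/
theorem setLIntegral_haar_chartAt_image (u : Matrix.specialUnitaryGroup (Fin 2) ℂ) {s : ℝ} (hs : s ≤ Real.pi)
    (G : Matrix.specialUnitaryGroup (Fin 2) ℂ → ℝ≥0∞) (hG : Measurable G) :
    ∫⁻ U in chartAt u '' ball (0 : EuclideanSpace ℝ (Fin 3)) s, G U ∂(haarProbability (Matrix.specialUnitaryGroup (Fin 2) ℂ)) =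
      ENNReal.ofReal (sigmaSU2 0) * ∫⁻ A in ball (0 : EuclideanSpace ℝ (Fin 3)) s, G (chartAt u A) * ENNReal.ofReal (chartJac A) := by
  rw [haar_restrict_chartAt_image_eq_smul u hs, lintegral_smul_measure, smul_eq_mul, lintegral_map hG (measurable_chartAt u),
    lintegral_withDensity_eq_lintegral_mul_non_measurable _ measurable_ofReal_chartJac (Filter.Eventually.of_forall fun _ => ENNReal.ofReal_lt_top) _]
  congr 1
  refine lintegral_congr fun A => ?_
  rw [Pi.mul_apply, mul_comm]

end OneBond

end Summit.QuantumFields.YangMills.Theorems.BalabanUVNodesPortS1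

end
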